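import Mathlib
import Literature.Analysis.FluidPDE.ClassicalSolution
import Literature.Analysis.FluidPDE.VectorCalculus
import Summits.NavierStokesRegularity.NavierStokesRegularity.Theses.ThreadingFlux

/-! # Sketch — crux idea «linear-loop-law» (negation lens) for `PoloidalLiouville` (stmt-NavierStokesRegularity-1222)

Walls: W1 = `stub_scalarLiouville` (1222, sieve reading only) and W2 = `stub_shearedRigidity` (27585, rung reading).
Typed first lemmas — `Prop`s only, nothing is proved in this file, NS regularity is NOT proved by any of this.

SETTING (frozen time, kinematic).  `v : ℝ³ → ℝ³` bounded, divergence-free, real-analytic, with UNTHREADED vorticity about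
`x₀`: `curl v = ∇T × y`, `y = x − x₀`, `r = ‖y‖`.  Loop momentum `m := ⟪v, y⟫`.  The ORDER-ONE threading coefficient of the
Navier–Stokes evolution from the datum `v` is `c₁ = ⟪y, ∂ₜ curl u⟫|_{t₀} = −⟪y, curl (ω × v)⟫ = ⟪ω, ∇m⟫ = det(y, ∇m, ∇T)`
(`LoopMomentumIdentity`, `FirstOrderLawOfUnthreadedEvolution`): the datum of an unthreaded evolution satisfies the LOOP LAW
`det(y, ∇m, ∇T) ≡ 0`, i.e. on every sphere `S_r(x₀)` the loop momentum is a function of the potential along the vortex loops.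

NEGATION LENS — build the simplest SHEARED unthreaded data and read off the typed obstruction:
* PURE-DEGREE SECTOR `T(x₀+y) = P_r(y)`, `P_r ∈ 𝓗_l` (solid harmonics of one degree `l`, shape free to turn / deform with `r`).
  (a) `Δm = Δ_S T` (from `div v = 0`) and boundedness of `v` force `m = G_r(y) + ⟪b, y⟫`, `G_r ∈ 𝓗_l`, `b = v(x₀)`;
  (b) SAME-DEGREE BRACKET RIGIDITY (`SameDegreeBracketRigidity`; proved by hand for `l ≤ 2`, checked by exact linear algebra
      for `l ≤ 5`): `det(y, ∇A, ∇B) ≡ 0`, `A, B ∈ 𝓗_l`, `A ≠ 0` ⇒ `B ∈ ℝA`; hence `G_r = λ(r) P_r` (parity split: for even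
      `l` the drift term `det(y, b, ∇P_r) ∈ 𝓗_l` separates from the odd-degree bracket and must vanish on its own);
  (c) KINEMATIC TRANSPORT (from `div v = 0`, `curl v = ∇T × y`; engine-verified `l = 1,2,3`): with
      `W := r^{-2l-2} ∫₀^r s^{2l+2} P_s ds` one has `G' = −l(l+1) W`, `W' = P − (2l+2) W / r`, so `Π := λP = G` satisfies the
      ENTRYWISE scalar ODE `Π″ + (2l+2) Π′/r + l(l+1) Π/λ = 0` — the shape `P_r` moves in a fixed pencil (2-plane) of `𝓗_l`;
  (d) FROBENIUS AT THE CENTRE: `λ → λ₀ ≠ 0` gives indicial roots `{0, −(2l+1)}`, and `λ ∼ −l(l+1) r² /((2j+2)(2j+2l+3))`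
      (stagnant centre, `P_r ∼ r^{2j}`) gives roots `{2j+2, −(2j+2l+3)}`: exactly ONE branch is regular, so analyticity at `x₀`
      collapses the pencil to a line: `P_r = φ(r) · A` — a SINGLE-DEGREE SHELL (fixed shape), `PureDegreeShapeRigidity`;
      for even `l` and `b ≠ 0` moreover `A` is zonal about `b` (`EvenDegreeDriftZonality`): axisymmetric without swirl already
      at ORDER ONE.  Control (engine): `P_r = e^{−r²} diag(1,−1,0) + r² e^{−r²} diag(1,1,−2)` has
      `c₁ ∝ −11r⁴/7 + 156r⁶/77 − ⋯ ≢ 0`.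
* ISO-λ MULTI-SHELLS (the construction that SUCCEEDS): the loop law is satisfied identically whenever `m = λ(r) T` on every
  sphere (LINEAR loop law).  Several degrees may then coexist with UNRELATED shapes, their radial profiles slaved to one `λ`:
  e.g. `T = φ(r)⟪y, Ay⟫ + ρ(r)⟪n, y⟫` with ANY traceless symmetric `A` (biaxial allowed) and ANY direction `n`, `φ > 0`
  decaying, `λ := G/φ > 0`, `g″ + 4g′/r + 2g/λ = 0` regular, `ρ := g/λ` (`IsoLambdaShellExists`; numeric instance
  `φ = e^{−r²}`: `λ₀ = 0.6`, drift `‖v(x₀)‖ = 1` along `n`, uniform flow `0.1328·n` at infinity, `C₁ ≈ 10⁻⁶` vs `10⁻²` control).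
  These bounded analytic non-axisymmetric fields pass ORDER ONE; they are neither single-degree shells nor common-α towers.
  DICHOTOMY: linear loop law ⇒ iso-λ multi-shell (each degree a fixed shape); a genuinely sheared order-one survivor needs a
  NONLINEAR loop law `m|_{S_r} = Φ_r(T|_{S_r})`, which forces algebraic relations between the harmonic components of `T`
  (tower type).  CONJECTURE (`IsoLambdaThreadsAtOrderTwo`, plan-only): iso-λ shells with two non-coaxial sectors thread at
  ORDER TWO (evidence: for the decaying subfamily, ReynoldsQuadrupole's `FarFieldQuadrupoleLaw` + bracket rigidity force
  `A` uniaxial about `n` unless the Reynolds quadrupole vanishes).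

Prior art inside the tree, cited not claimed: `l = 1` (precessing dipole / twisted cap) is ns-idea-13 g2's
`CapSym.TwistedCapIsDipole` / `CapSym.TwistedCapNoTwist` (TwistedCapKinematics.md §B–§D); fixed-shape shells at ORDER TWO are
g0's `StubSingleDegreeRung` / ReynoldsQuadrupole `L2ShellRung`; the mixed-shape algebra is ReynoldsQuadrupole
`HarmonicBracketRigidity` (harmonic × quadratic form); the loop law as "local law `m = M(T, r)` off the critical set" is
`StubLevelSetLocalLaw` (ns-idea-6).  NEW here: arbitrary-shape pure sectors of every degree decided at ORDER ONE by the
transport pencil + Frobenius mechanism, even-degree drift zonality, the iso-λ family, the linear/nonlinear dichotomy. -/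

set_option linter.dupNamespace false

namespace Summit.NavierStokesRegularity.NavierStokesRegularity.Cruxes.PoloidalLiouville.LoopLaw

open Set
open Literature.Analysis.FluidPDE (cross curl IsClassicalNSSolutionOn)

/-- ℝ³. -/
abbrev E3 : Type := EuclideanSpace ℝ (Fin 3)

/-- Evaluation of a real polynomial in three variables at a point of `ℝ³`. -/
noncomputable def peval (P : MvPolynomial (Fin 3) ℝ) (y : E3) : ℝ := MvPolynomial.eval (fun i => y i) P

/-- `P` is a solid harmonic of degree `l`: homogeneous of degree `l` and harmonic (`P ∈ 𝓗_l`, `dim 𝓗_l = 2l+1`). -/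
def IsSolidHarmonic (l : ℕ) (P : MvPolynomial (Fin 3) ℝ) : Prop :=
  P.IsHomogeneous l ∧ ∀ y : E3, Laplacian.laplacian (peval P) y = 0

/-- The loop bracket `{f, g}(y) = det(y, ∇f(y), ∇g(y)) = ⟪y, ∇f × ∇g⟫` (Poisson bracket of the restrictions to the sphere
through `y`; `{m, T} = ⟪ω, ∇m⟫` when `ω = ∇T × y`). -/
noncomputable def loopBracket (f g : E3 → ℝ) (y : E3) : ℝ := inner ℝ y (cross (gradient f y) (gradient g y))

/-- Traceless symmetric endomorphism of `ℝ³` (verbatim ReynoldsQuadrupole's `IsShapeTensor`): `y ↦ ⟪y, Ay⟫` is then a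
solid harmonic of degree 2, and every element of `𝓗₂` is of this form. -/
def IsTracelessSymmetric (A : E3 →L[ℝ] E3) : Prop :=
  (∀ a b : E3, inner ℝ (A a) b = inner ℝ a (A b)) ∧ LinearMap.trace ℝ E3 (A : E3 →ₗ[ℝ] E3) = 0

/-- Loop momentum `m(x) = ⟪v x, x − x₀⟫`. -/
noncomputable def loopMomentum (v : E3 → E3) (x₀ : E3) (x : E3) : ℝ := inner ℝ (v x) (x - x₀)

/-- The loop bracket about the centre `x₀`: `det(x − x₀, ∇f(x), ∇g(x))`. -/
noncomputable def loopBracketAt (x₀ : E3) (f g : E3 → ℝ) (x : E3) : ℝ :=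
  inner ℝ (x - x₀) (cross (gradient f x) (gradient g x))

/-- FIRST-ORDER-UNTHREADED FIELD about `x₀` with toroidal potential `T` (frozen time, kinematic): `v ∈ C³` bounded,
real-analytic, divergence-free; `curl v = ∇T × (x − x₀)` off `x₀` (so `⟪curl v, x − x₀⟫ ≡ 0`: unthreaded); and the LOOP LAW
`det(x − x₀, ∇m, ∇T) = 0` off `x₀` (= vanishing of the order-one threading coefficient, `LoopMomentumIdentity`).  `T` is only
asked to be `C²` off `x₀` (it is determined by `v` up to radial functions; `gradient T x₀` is never used). -/
def IsFirstOrderUnthreadedAt (v : E3 → E3) (x₀ : E3) (T : E3 → ℝ) : Prop :=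
  ContDiff ℝ 3 v ∧ AnalyticOnNhd ℝ v univ ∧ (∃ M : ℝ, ∀ x, ‖v x‖ ≤ M) ∧ Literature.Analysis.FluidPDE.VectorCalculus.IsDivFree v ∧
    ContDiffOn ℝ 2 T {x₀}ᶜ ∧ (∀ x, x ≠ x₀ → curl v x = cross (gradient T x) (x - x₀)) ∧
    ∀ x, x ≠ x₀ → loopBracketAt x₀ (loopMomentum v x₀) T x = 0

/-! ## Algebra: same-degree bracket rigidity -/

/-- (K-alg, finite-dimensional; rank-2 lemma) **Same-degree bracket rigidity.** Two solid harmonics of the same degree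
`l ≥ 1` whose loop bracket vanishes identically are proportional.  (`l = 1`: `det(y,a,b) ≡ 0 ⇒ a ∥ b`; `l = 2`: the
`𝓗₁`-component of `det(y, Ay, By)` is the axial vector of `[A, B]`, so `A, B` commute, are co-diagonal, and
`det(𝟙, α, β) = 0` with `tr = 0` gives `β ∈ ℝα`; `l ≤ 5`: kernel of `B ↦ {A, B}` computed to be `ℝA` for random and for all
zonal / sectoral / tesseral / polyhedral `A` (engine `bracket_rigidity2.py`), and `l ≤ 8` for random `A` and ALL `Y_lm`-types
(`bracket_rigidity3/4.py`, v1.1); general `l` — ROUTE (card v1.1, critic V13-P1): `{A,B} ≡ 0` on `S²` ⇒ `B = F(A)` locally off `Crit A`;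
both are `Δ_S`-eigenfunctions with eigenvalue `−l(l+1)` ⇒ `F″(A)|∇_S A|² = l(l+1)(A F′(A) − F(A))`; so either `F` is affine on an open set
(⇒ `B = cA` by analyticity) or `|∇_S A|²` is a function of `A` on an open set — `A` is then transnormal AND `Δ_S A = −l(l+1)A`, i.e.
ISOPARAMETRIC (Cartan; Q.-M. Wang, Math. Ann. 277 (1987); survey [corpus:paper:arxiv-1403.6980 pp 3–4]) ⇒ level curves are coaxial
circles ⇒ `A` zonal ⇒ `B` zonal of degree `l` about the same axis ⇒ `B = cA`.  NOT landed: the rungs below that need it for `l ≥ 9` carry it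
as an explicit hypothesis in their priced forms `…OfBR` (V13-P1).)  Why it might fail: an exotic `A ∈ 𝓗_l`, `l ≥ 9`, with a
2-dimensional commuting plane (the isoparametric route says there is none). -/
def SameDegreeBracketRigidity : Prop :=
  ∀ (l : ℕ) (A B : MvPolynomial (Fin 3) ℝ), 1 ≤ l → IsSolidHarmonic l A → IsSolidHarmonic l B → A ≠ 0 →
    (∀ y : E3, loopBracket (peval A) (peval B) y = 0) → ∃ c : ℝ, B = c • A

/-- (K-alg at a fixed degree `l` — the hypothesis form used by the priced rungs, V13-P1.) -/
def SameDegreeBracketRigidityAt (l : ℕ) : Prop :=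
  ∀ (A B : MvPolynomial (Fin 3) ℝ), IsSolidHarmonic l A → IsSolidHarmonic l B → A ≠ 0 →
    (∀ y : E3, loopBracket (peval A) (peval B) y = 0) → ∃ c : ℝ, B = c • A

/-- (K-alg₂, the degree-2 case in matrix form, proved by hand — see the docstring above.) -/
def QuadraticBracketRigidity : Prop :=
  ∀ (A B : E3 →L[ℝ] E3), IsTracelessSymmetric A → IsTracelessSymmetric B → A ≠ 0 →
    (∀ y : E3, inner ℝ y (cross (A y) (B y)) = 0) → ∃ c : ℝ, B = c • A

/-! ## Kinematics: the order-one coefficient is the loop bracket -/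

/-- (K-id, S-sized calculus) **Loop-momentum identity.** For `v ∈ C²` divergence-free with `curl v = ∇T × (x − x₀)` off `x₀`:
`⟪x − x₀, curl (curl v × v)⟫ = −det(x − x₀, ∇m, ∇T)`, `m = ⟪v, x − x₀⟫`.  (Proof: `curl (ω × v) = (v·∇)ω − (ω·∇)v`,
`⟪y,(v·∇)ω⟫ = (v·∇)⟪y,ω⟫ − ⟪ω,v⟫`, `⟪y,(ω·∇)v⟫ = ⟪ω,∇m⟫ − ⟪v,ω⟫`, and `⟪y, ω⟫ ≡ 0`.) -/
def LoopMomentumIdentity : Prop :=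
  ∀ (v : E3 → E3) (x₀ : E3) (T : E3 → ℝ), ContDiff ℝ 2 v → Literature.Analysis.FluidPDE.VectorCalculus.IsDivFree v → ContDiffOn ℝ 2 T {x₀}ᶜ →
    (∀ x, x ≠ x₀ → curl v x = cross (gradient T x) (x - x₀)) →
    ∀ x, x ≠ x₀ →
      inner ℝ (x - x₀) (curl (fun z => cross (curl v z) (v z)) x) = - loopBracketAt x₀ (loopMomentum v x₀) T x

/-- (K-bridge, M) **First-order law of an unthreaded evolution (data level, non-vacuous).** If a classical Navier–Stokes
solution on `[t₀, t₁)` (smooth up to `t = t₀`, `ν = 1`, no force) has unthreaded vorticity about `x₀` for `t ∈ (t₀, t₁)`,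
then its DATUM satisfies the pressure-free order-one condition `⟪x − x₀, curl (ω × u)(t₀)⟫ ≡ 0`.
(`F = ⟪curl u, x − x₀⟫` vanishes on `[t₀,t₁)` by continuity, so `∂ₜ⁺F(t₀) = 0`; `∂ₜ curl u = Δ curl u − curl ((u·∇)u)`,
`(u·∇)u = ω × u + ∇|u|²/2`, and `⟪y, Δω⟫ = ΔF − 2 div ω = 0` at `t₀`.) -/
def FirstOrderLawOfUnthreadedEvolution : Prop :=
  ∀ (u : ℝ → E3 → E3) (p : ℝ → E3 → ℝ) (x₀ : E3) (t₀ t₁ : ℝ), t₀ < t₁ →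
    IsClassicalNSSolutionOn (Ico t₀ t₁) 1 0 u p →
    (∀ t ∈ Ioo t₀ t₁, ∀ x : E3, inner ℝ (curl (u t) x) (x - x₀) = 0) →
    ∀ x : E3, inner ℝ (x - x₀) (curl (fun z => cross (curl (u t₀) z) (u t₀ z)) x) = 0

/-! ## The rung: pure-degree shape rigidity at order one -/

/-- (RUNG, M–L) **Pure-degree shape rigidity.** A first-order-unthreaded field (bounded, analytic, divergence-free,
`curl v = ∇T × y`, loop law) whose toroidal potential is PURE DEGREE `l ≥ 1` on every sphere about `x₀` —
`T(x₀ + y) = P_{‖y‖}(y)` with `P_r ∈ 𝓗_l` — has a FIXED SHAPE: `P_r = φ(r) · A` for one `A ∈ 𝓗_l` (a single-degree shell).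
Parity proviso: for odd `l ≥ 3` the centre is assumed stagnant (`v x₀ = 0`); for even `l`, and for `l = 1`
(= ns-idea-13's `TwistedCapNoTwist` regime), any drift is allowed.  Mechanism: (a)–(d) of the module docstring.
Why it might fail: the Frobenius bookkeeping at a centre where `P_r` vanishes to high order together with `λ`, or an
odd-`l` drift coupling overlooked in the parity split. -/
def PureDegreeShapeRigidity : Prop :=
  ∀ (l : ℕ) (v : E3 → E3) (x₀ : E3) (T : E3 → ℝ) (P : ℝ → MvPolynomial (Fin 3) ℝ), 1 ≤ l →
    IsFirstOrderUnthreadedAt v x₀ T →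
    (∀ r : ℝ, 0 < r → IsSolidHarmonic l (P r)) →
    (∀ y : E3, y ≠ 0 → T (x₀ + y) = peval (P ‖y‖) y) →
    (v x₀ = 0 ∨ Even l ∨ l = 1) →
    ∃ (A : MvPolynomial (Fin 3) ℝ) (φ : ℝ → ℝ), IsSolidHarmonic l A ∧ ∀ r : ℝ, 0 < r → P r = φ r • A

/-- (RUNG₂, the degree-2 case in matrix form — biaxial / precessing quadrupole shells are excluded at ORDER ONE.)
`T(x₀ + y) = ⟪y, Q(‖y‖) y⟫` with `Q(r)` traceless symmetric ⇒ `Q(r) = φ(r) · A`. -/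
def QuadrupoleShapeRigidity : Prop :=
  ∀ (v : E3 → E3) (x₀ : E3) (T : E3 → ℝ) (Q : ℝ → (E3 →L[ℝ] E3)),
    IsFirstOrderUnthreadedAt v x₀ T →
    (∀ r : ℝ, 0 < r → IsTracelessSymmetric (Q r)) →
    (∀ y : E3, y ≠ 0 → T (x₀ + y) = inner ℝ y (Q ‖y‖ y)) →
    ∃ (A : E3 →L[ℝ] E3) (φ : ℝ → ℝ), IsTracelessSymmetric A ∧ ∀ r : ℝ, 0 < r → Q r = φ r • A

/-- (RUNG-even, M) **Even-degree drift zonality.** In the situation of `PureDegreeShapeRigidity` with `l` even and a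
NON-STAGNANT centre `b := v x₀ ≠ 0`, the shape is ZONAL about `b` (the drift term `det(y, b, ∇P_r) = −(R_b P_r)(y) ∈ 𝓗_l`
has the parity of `l`, the bracket `{G_r, P_r}` the opposite one): the slice is axisymmetric without swirl about the axis
`x₀ + ℝb` — at ORDER ONE.  (`l = 2`: `det(y, b, Qy) ≡ 0 ⇔ Q` uniaxial about `b`, ReynoldsQuadrupole
`HarmonicBracketRigidity` with `l = 1`.) -/
def EvenDegreeDriftZonality : Prop :=
  ∀ (l : ℕ) (v : E3 → E3) (x₀ : E3) (T : E3 → ℝ) (P : ℝ → MvPolynomial (Fin 3) ℝ), 2 ≤ l → Even l →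
    IsFirstOrderUnthreadedAt v x₀ T →
    (∀ r : ℝ, 0 < r → IsSolidHarmonic l (P r)) →
    (∀ y : E3, y ≠ 0 → T (x₀ + y) = peval (P ‖y‖) y) →
    v x₀ ≠ 0 →
    ∀ r : ℝ, 0 < r → ∀ R : E3 ≃ₗᵢ[ℝ] E3, R (v x₀) = v x₀ → ∀ y : E3, peval (P r) (R y) = peval (P r) y

/-- (W2-type DATUM RUNG, non-vacuous, L) **Pure-degree data of an unthreaded evolution are single-degree shells.**
A classical NS solution on `[t₀,t₁)`, unthreaded about `x₀` on `(t₀,t₁)`, whose datum `u t₀` is bounded, analytic and has a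
pure-degree-`l` toroidal potential (parity proviso as above) has a single-degree-shell datum.  (= `FirstOrderLaw…` +
`LoopMomentumIdentity` + `PureDegreeShapeRigidity`.)  With `l = 2`, `u t₀ x₀ ≠ 0`: the datum is axisymmetric without swirl
(`EvenDegreeDriftZonality`); with `l = 2`, decay, and the order-two law `L2ShellRung` (ReynoldsQuadrupole) also the stagnant
case.  This is the part of W2's `stub_shearedRigidity` that closes at ORDER ONE.  NON-VACUITY: the datum at the
initial time `t₀` is freely prescribable (no exact slice at an interior time is assumed), and the hypothesis class contains every
zonal fixed-shape shell datum (axisymmetric swirl-free evolutions are unthreaded about axis points) — instances on both sides.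
V13 LABELS: (P4) the analytic bounded DATUM (`AnalyticOnNhd ℝ (u t₀) univ`, `‖u t₀‖ ≤ M`) and the `C²` toroidal potential off `x₀` are
INPUTS of this rung, not consequences of `IsClassicalNSSolutionOn (Ico t₀ t₁)`; (P3) CLASS RESTRICTION: for ODD `l ≥ 3` only STAGNANT centres
(`u t₀ x₀ = 0`) are covered — the parity split fails otherwise; (P1) for `l ≥ 9` the statement leans on `SameDegreeBracketRigidity`
(engine-verified `l ≤ 8` only) — the priced form with the explicit hypothesis is `PureDegreeDatumRungOfBR`. -/
def PureDegreeDatumRung : Prop :=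
  ∀ (l : ℕ) (u : ℝ → E3 → E3) (p : ℝ → E3 → ℝ) (x₀ : E3) (t₀ t₁ : ℝ) (T : E3 → ℝ)
    (P : ℝ → MvPolynomial (Fin 3) ℝ), 1 ≤ l → t₀ < t₁ →
    IsClassicalNSSolutionOn (Ico t₀ t₁) 1 0 u p →
    (∀ t ∈ Ioo t₀ t₁, ∀ x : E3, inner ℝ (curl (u t) x) (x - x₀) = 0) →
    AnalyticOnNhd ℝ (u t₀) univ → (∃ M : ℝ, ∀ x, ‖u t₀ x‖ ≤ M) →
    ContDiffOn ℝ 2 T {x₀}ᶜ → (∀ x, x ≠ x₀ → curl (u t₀) x = cross (gradient T x) (x - x₀)) →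
    (∀ r : ℝ, 0 < r → IsSolidHarmonic l (P r)) →
    (∀ y : E3, y ≠ 0 → T (x₀ + y) = peval (P ‖y‖) y) →
    (u t₀ x₀ = 0 ∨ Even l ∨ l = 1) →
    ∃ (A : MvPolynomial (Fin 3) ℝ) (φ : ℝ → ℝ), IsSolidHarmonic l A ∧ ∀ r : ℝ, 0 < r → P r = φ r • A

/-- (RUNG, priced form V13-P1) `PureDegreeShapeRigidity` at degree `l` FROM same-degree bracket rigidity at `l` as an explicit
hypothesis — unconditional for `l ≤ 2` once `QuadraticBracketRigidity` lands; the load-bearing algebra is visible. -/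
def PureDegreeShapeRigidityOfBR : Prop :=
  ∀ (l : ℕ), 1 ≤ l → SameDegreeBracketRigidityAt l →
  ∀ (v : E3 → E3) (x₀ : E3) (T : E3 → ℝ) (P : ℝ → MvPolynomial (Fin 3) ℝ),
    IsFirstOrderUnthreadedAt v x₀ T →
    (∀ r : ℝ, 0 < r → IsSolidHarmonic l (P r)) →
    (∀ y : E3, y ≠ 0 → T (x₀ + y) = peval (P ‖y‖) y) →
    (v x₀ = 0 ∨ Even l ∨ l = 1) →
    ∃ (A : MvPolynomial (Fin 3) ℝ) (φ : ℝ → ℝ), IsSolidHarmonic l A ∧ ∀ r : ℝ, 0 < r → P r = φ r • A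

/-- (W2-type DATUM RUNG, priced form V13-P1) `PureDegreeDatumRung` at degree `l` FROM `SameDegreeBracketRigidityAt l`. -/
def PureDegreeDatumRungOfBR : Prop :=
  ∀ (l : ℕ), 1 ≤ l → SameDegreeBracketRigidityAt l →
  ∀ (u : ℝ → E3 → E3) (p : ℝ → E3 → ℝ) (x₀ : E3) (t₀ t₁ : ℝ) (T : E3 → ℝ)
    (P : ℝ → MvPolynomial (Fin 3) ℝ), t₀ < t₁ →
    IsClassicalNSSolutionOn (Ico t₀ t₁) 1 0 u p →
    (∀ t ∈ Ioo t₀ t₁, ∀ x : E3, inner ℝ (curl (u t) x) (x - x₀) = 0) →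
    AnalyticOnNhd ℝ (u t₀) univ → (∃ M : ℝ, ∀ x, ‖u t₀ x‖ ≤ M) →
    ContDiffOn ℝ 2 T {x₀}ᶜ → (∀ x, x ≠ x₀ → curl (u t₀) x = cross (gradient T x) (x - x₀)) →
    (∀ r : ℝ, 0 < r → IsSolidHarmonic l (P r)) →
    (∀ y : E3, y ≠ 0 → T (x₀ + y) = peval (P ‖y‖) y) →
    (u t₀ x₀ = 0 ∨ Even l ∨ l = 1) →
    ∃ (A : MvPolynomial (Fin 3) ℝ) (φ : ℝ → ℝ), IsSolidHarmonic l A ∧ ∀ r : ℝ, 0 < r → P r = φ r • A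

/-! ## The construction that succeeds: iso-λ multi-shells -/

/-- (EXHIBIT-claim (M), NOT evidence for any rung — V13-P2: rests on the card's ODE construction + numerics (φ = e^{−r²}: λ₀ = 0.600,
FD residuals 1e-5/1e-6; v1.2: the construction's identities `div v ≡ 0`, `curl v ≡ ∇T×y`, `m ≡ λT`, `c₁ ≡ 0` verified EXACTLY in the
order-two engine, `Cruxes/PoloidalLiouville/IsoLambdaOrderTwo-RESULTS.md`); the ODE existence / analyticity at 0 / boundedness of `g`
are not landed) **Iso-λ dipole–quadrupole shells exist.**
There is a first-order-unthreaded field about `0` (bounded, analytic, divergence-free, unthreaded, loop law) whose potential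
`T(y) = φ(‖y‖)⟪y, Ay⟫ + ρ(‖y‖)⟪n, y⟫` carries a BIAXIAL quadrupole shape `A` (three distinct eigenvalues:
`det(y, Ay, A²y) ≢ 0`, so the field is axisymmetric about no axis) and a dipole along an arbitrary `n ≠ 0`, both sectors
non-trivial, with non-zero drift `v 0 ≠ 0`.  By `QuadrupoleShapeRigidity`/`EvenDegreeDriftZonality` the quadrupole sector
ALONE could not do this: the slaved dipole (`ρ = g/λ`, `λ = m/T`) is what cancels the drift term.  These slices pass ORDER
ONE and are neither single-degree shells nor common-α towers — the next test family for W2's `stub_shearedRigidity`. -/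
def IsoLambdaShellExists : Prop :=
  ∃ (v : E3 → E3) (T : E3 → ℝ) (A : E3 →L[ℝ] E3) (n : E3) (φ ρ : ℝ → ℝ),
    IsTracelessSymmetric A ∧ (∃ y : E3, inner ℝ y (cross (A y) (A (A y))) ≠ 0) ∧ n ≠ 0 ∧
    (∀ y : E3, y ≠ 0 → T y = φ ‖y‖ * inner ℝ y (A y) + ρ ‖y‖ * inner ℝ n y) ∧
    (∃ r : ℝ, 0 < r ∧ φ r ≠ 0 ∧ ρ r ≠ 0) ∧
    IsFirstOrderUnthreadedAt v 0 T ∧ v 0 ≠ 0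

/-- (CONJECTURE, plan-only; cheapest falsifier of the whole line = an exact radial order-two engine run on this family)
**Iso-λ shells thread at order two.** No classical NS evolution on `[t₀,t₁)` from an iso-λ dipole–quadrupole datum
(biaxial `A`, both sectors non-trivial) stays unthreaded about the centre on `(t₀,t₁)`.  Evidence: for the decaying
subfamily, ReynoldsQuadrupole's `FarFieldQuadrupoleLaw` and bracket rigidity force `A` uniaxial about `n` unless the
Reynolds quadrupole vanishes; v1.2 DATUM O2-isoλ (`IsoLambdaOrderTwo-RESULTS.md`, 0 kit): the order-two coefficient
`c₂ = y·curl(v₁×ω₀ + v₀×ω₁)` is NON-ZERO on 7/7 non-axisymmetric instances (linear in the tilt `a × n` and in the biaxiality; zero set =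
the axisymmetric locus; control 7e-17).  Labelled CONJECTURE (numerically confirmed, not proved); not used by any rung above. -/
def IsoLambdaThreadsAtOrderTwo : Prop :=
  ∀ (u : ℝ → E3 → E3) (p : ℝ → E3 → ℝ) (x₀ : E3) (t₀ t₁ : ℝ) (T : E3 → ℝ) (A : E3 →L[ℝ] E3) (n : E3)
    (φ ρ : ℝ → ℝ), t₀ < t₁ →
    IsClassicalNSSolutionOn (Ico t₀ t₁) 1 0 u p →
    IsTracelessSymmetric A → (∃ y : E3, inner ℝ y (cross (A y) (A (A y))) ≠ 0) → n ≠ 0 →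
    (∀ y : E3, y ≠ 0 → T (x₀ + y) = φ ‖y‖ * inner ℝ y (A y) + ρ ‖y‖ * inner ℝ n y) →
    (∃ r : ℝ, 0 < r ∧ φ r ≠ 0 ∧ ρ r ≠ 0) →
    IsFirstOrderUnthreadedAt (u t₀) x₀ T →
    ¬ (∀ t ∈ Ioo t₀ t₁, ∀ x : E3, inner ℝ (curl (u t) x) (x - x₀) = 0)

end Summit.NavierStokesRegularity.NavierStokesRegularity.Cruxes.PoloidalLiouville.LoopLaw
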